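import Mathlib
import Summits.Ventures.DiscreteObjects.Mahler.CensusTrigCuts
import Summits.Ventures.DiscreteObjects.Mahler.CensusHalfSearch

/-!
# The kernel census search WITH Fejér–Riesz cuts, and its soundness (venture `DiscreteObjects`, target L)

Cell `pub-namedobj`, seat `pub-namedobj-mahler-g13`. Framing: lottery ticket; floor = certified bounds/negative
ranges.

`censusSearchC T CT d [] []` enumerates the half coefficient vectors `[c₁,…,c_d]` of the monic palindromic integer
polynomials of degree `2d` whose power sums pass the elementary tests `|P_k| ≤ T_k` (`k ≤ |T|`, mahler g2/g12) AND the
cuts of the table `CT`: entry `k-1` of `CT` lists pairs `([λ_k,…,λ_1], N)` meaning `0 ≤ N + Σ_{j≤k} λ_j P_j`; at a node of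
depth `k-1` (power sums `[P_{k-1},…,P_1]` carried along) each cut is a one-sided bound on `P_k`, hence on `c_k`
(`cutBounds`); the leaf tests `k = d+1,…,|T|` are applied lazily (`leafPass`). SOUNDNESS
(`take_descCoeffList_mem_censusSearchC`): for a monic palindromic `p ∈ ℤ[X]` of degree `2d ≥ 2` with `M(p) < B`,
valid thresholds (`ThresholdsValid`) and a valid cut table (`CutTableValid d B CT`: every cut comes from an integer
vector `v` of length `k+1` with `2dλ₀(v) + Σ_j |λ_j(v)|(B^j+B^{-j}-2) < N+1`, see `CensusTrigCuts.trigCut_halfRoots`), the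
half vector of `p` is in the output. The verdicts, the Boolean validation of a cut table and the one-level unfolding
used for chunking are in `CensusSearchCutsVerdict`. At degree 14 and `B = 13/10` sixty cuts shrink the search from
3.1·10⁶ to 1.75·10⁵ leaves (`c₁ ≥ 0`).
-/

namespace Summit.Ventures.DiscreteObjects.Mahler

open Polynomial

/-! ## Definitions (evaluated by the kernel) -/

/-- Fold the cuts of one depth into bounds `(lo, hi)` for the next power sum `p`: a cut `(lk :: rest, N)` says
`0 ≤ N + lk·p + Σ rest·ps` (`ps = [p_{k-1},…,p_1]`). -/
def cutBounds : List (List ℤ × ℤ) → List ℤ → ℤ → ℤ → ℤ × ℤ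
  | [], _, lb, ub => (lb, ub)
  | ([], _) :: cs, ps, lb, ub => cutBounds cs ps lb ub
  | (lk :: rest, N) :: cs, ps, lb, ub =>
    if 0 < lk then cutBounds cs ps (max lb (-((N + (List.zipWith (· * ·) rest ps).sum) / lk))) ub
    else if lk < 0 then cutBounds cs ps lb (min ub ((N + (List.zipWith (· * ·) rest ps).sum) / (-lk)))
    else cutBounds cs ps lb ub

/-- Lazy leaf test: further Newton steps on the coefficient list `cs` against the remaining thresholds `ts`,
starting from the power sums `ps` (most recent first). -/
def leafPass (cs : List ℤ) : List ℕ → List ℤ → Bool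
  | [], _ => true
  | t :: ts, ps =>
    let p := newtonNext cs ps
    decide (p.natAbs ≤ t) && leafPass cs ts (p :: ps)

/-- The census search with cuts: `fuel` coefficients still to choose, `pre` the chosen ones and `ps = [P_{|pre|},…,P_1]`
their power sums. -/
def censusSearchC (T : List ℕ) (CT : List (List (List ℤ × ℤ))) : ℕ → List ℤ → List ℤ → List (List ℤ)
  | 0, pre, ps => if leafPass (palC pre) (T.drop pre.length) ps then [pre] else []
  | fuel + 1, pre, ps =>
    let R : ℤ := -(List.zipWith (· * ·) pre ps).sum
    let kz : ℤ := ((pre.length + 1 : ℕ) : ℤ)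
    let b := cutBounds (CT.getD pre.length []) ps (-((T.getD pre.length 0 : ℕ) : ℤ)) ((T.getD pre.length 0 : ℕ) : ℤ)
    (icc (-((b.2 - R) / kz)) ((R - b.1) / kz)).flatMap fun ak =>
      censusSearchC T CT fuel (pre ++ [ak]) ((-(kz * ak) + R) :: ps)

/-- A cut `([λ_k,…,λ_1], N)` at depth `k` is VALID for `(d, B)` if it comes from an integer vector `v` of length `k+1`
with `2d·λ₀(v) + Σ_{j=1}^{k} |λ_j(v)|·(B^j + B^{-j} - 2) < N + 1`. -/
def CutValid (d k : ℕ) (B : ℝ) (c : List ℤ × ℤ) : Prop :=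
  c.1.length = k ∧ ∃ v : List ℤ, v.length = k + 1 ∧ (∀ j < k, c.1.getD (k - 1 - j) 0 = lamAt v (j + 1)) ∧
    2 * (d : ℝ) * ((lamZero v : ℤ) : ℝ) +
        ∑ j ∈ Finset.range k, |((lamAt v (j + 1) : ℤ) : ℝ)| * (B ^ (j + 1) + (B ^ (j + 1))⁻¹ - 2) < (c.2 : ℝ) + 1

/-- Every cut of the table at every depth `1 ≤ k ≤ d` is valid. -/
def CutTableValid (d : ℕ) (B : ℝ) (CT : List (List (List ℤ × ℤ))) : Prop :=
  ∀ k, 1 ≤ k → k ≤ d → ∀ c ∈ CT.getD (k - 1) [], CutValid d k B c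

/-! ## Soundness of the bounds and of the leaf test -/

/-- `cutBounds` keeps `p` inside its bounds if `p` satisfies every (nonempty) cut. -/
theorem cutBounds_spec : ∀ (cuts : List (List ℤ × ℤ)) (ps : List ℤ) (lb ub p : ℤ), lb ≤ p → p ≤ ub →
    (∀ c ∈ cuts, 0 ≤ c.2 + (List.zipWith (· * ·) c.1 (p :: ps)).sum) →
    (cutBounds cuts ps lb ub).1 ≤ p ∧ p ≤ (cutBounds cuts ps lb ub).2 := by
  intro cuts
  induction cuts with
  | nil => intro ps lb ub p h1 h2 _; exact ⟨h1, h2⟩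
  | cons c cs ih =>
    intro ps lb ub p h1 h2 hc
    have hcs : ∀ c' ∈ cs, 0 ≤ c'.2 + (List.zipWith (· * ·) c'.1 (p :: ps)).sum :=
      fun c' hc' => hc c' (List.mem_cons_of_mem _ hc')
    obtain ⟨lams, N⟩ := c
    cases lams with
    | nil => exact ih ps lb ub p h1 h2 hcs
    | cons lk rest =>
      have h0 := hc (lk :: rest, N) List.mem_cons_self
      simp only [List.zipWith_cons_cons, List.sum_cons] at h0
      set A := N + (List.zipWith (· * ·) rest ps).sum with hA
      show (cutBounds ((lk :: rest, N) :: cs) ps lb ub).1 ≤ p ∧ p ≤ (cutBounds ((lk :: rest, N) :: cs) ps lb ub).2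
      simp only [cutBounds]
      split_ifs with hpos hneg
      · apply ih ps _ ub p _ h2 hcs
        refine max_le h1 ?_
        rw [neg_le, Int.le_ediv_iff_mul_le hpos]
        linarith
      · apply ih ps lb _ p h1 _ hcs
        refine le_min h2 ?_
        rw [Int.le_ediv_iff_mul_le (by omega)]
        linarith
      · exact ih ps lb ub p h1 h2 hcs

/-- The lazy leaf test passes if all further power sums are within the thresholds. -/
theorem leafPass_of_forall (cs : List ℤ) : ∀ (ts : List ℕ) (m : ℕ),
    (∀ i < ts.length, ((psumsRev cs (m + i + 1)).getD 0 0).natAbs ≤ ts.getD i 0) →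
    leafPass cs ts (psumsRev cs m) = true := by
  intro ts
  induction ts with
  | nil => intro m _; rfl
  | cons t ts ih =>
    intro m h
    have h0 := h 0 (by simp)
    simp only [Nat.add_zero, List.getD_cons_zero, psumsRev_succ, List.getD_cons_zero] at h0
    have hrest := ih (m + 1) (fun i hi => by
      have := h (i + 1) (by simpa using hi)
      rw [List.getD_cons_succ, show m + (i + 1) + 1 = m + 1 + i + 1 by ring] at this
      exact this)
    rw [psumsRev_succ] at hrest
    simp only [leafPass, h0, decide_true, hrest, Bool.and_self]

/-! ## Soundness of the search (list form) -/

/-- **Soundness of `censusSearchC` (list form).** If `|a| = d ≤ |T|`, `|P_k| ≤ T_k` for `1 ≤ k ≤ |T|` and every cut of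
depth `k ≤ d` holds for the power sums of `palC a`, then `a ∈ censusSearchC T CT d [] []`. -/
theorem mem_censusSearchC {T : List ℕ} {CT : List (List (List ℤ × ℤ))} {d : ℕ} (hdT : d ≤ T.length) (a : List ℤ)
    (ha : a.length = d)
    (hpass : ∀ k, 1 ≤ k → k ≤ T.length → ((psumsRev (palC a) k).getD 0 0).natAbs ≤ T.getD (k - 1) 0)
    (hcut : ∀ k, 1 ≤ k → k ≤ d → ∀ c ∈ CT.getD (k - 1) [],
      0 ≤ c.2 + (List.zipWith (· * ·) c.1 (psumsRev (palC a) k)).sum) :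
    a ∈ censusSearchC T CT d [] [] := by
  -- power sums of a prefix are those of the full list
  have hps : ∀ j ≤ d, psumsRev (a.take j) j = psumsRev (palC a) j := by
    intro j hj
    rw [← take_palC a (by omega), psumsRev_take _ _ _ le_rfl]
  suffices H : ∀ fuel pre, pre.length + fuel = d → pre = a.take pre.length →
      a ∈ censusSearchC T CT fuel pre (psumsRev (palC a) pre.length) by
    have := H d [] (by simp) (by simp)
    simpa using this
  intro fuel
  induction fuel with
  | zero =>
    intro pre hlen hpre
    have hpa : pre = a := by rw [hpre]; exact List.take_of_length_le (by omega)
    subst hpa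
    have hleaf : leafPass (palC pre) (T.drop pre.length) (psumsRev (palC pre) pre.length) = true := by
      apply leafPass_of_forall
      intro i hi
      rw [List.length_drop] at hi
      rw [show (T.drop pre.length).getD i 0 = T.getD (pre.length + i) 0 from by
        rw [List.getD_eq_getElem?_getD, List.getElem?_drop, ← List.getD_eq_getElem?_getD]]
      have := hpass (pre.length + i + 1) (by omega) (by omega)
      rwa [show pre.length + i + 1 - 1 = pre.length + i by omega] at this
    simp [censusSearchC, hleaf]
  | succ fuel ih =>
    intro pre hlen hpre
    rw [censusSearchC, List.mem_flatMap]
    have hka : pre.length + 1 ≤ a.length := by omega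
    have hPk := hpass (pre.length + 1) (by omega) (by omega)
    have hhead := head_psumsRev_palC a (pre.length + 1) (by omega) hka
    rw [Nat.add_sub_cancel, hps pre.length (by omega), ← hpre] at hhead
    rw [Nat.add_sub_cancel] at hPk
    have hcons : psumsRev (palC a) (pre.length + 1) = newtonNext (palC a) (psumsRev (palC a) pre.length) ::
        psumsRev (palC a) pre.length := psumsRev_succ _ _
    rw [hcons, List.getD_cons_zero] at hhead hPk
    set ps := psumsRev (palC a) pre.length with hpsdef
    set Pk := newtonNext (palC a) ps with hPkdef
    set S := (List.zipWith (· * ·) pre ps).sum with hS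
    set ak := a.getD pre.length 0 with hak
    set kz : ℤ := ((pre.length + 1 : ℕ) : ℤ) with hkz
    set Tk : ℤ := ((T.getD pre.length 0 : ℕ) : ℤ) with hTk
    have hkpos : (0 : ℤ) < kz := by rw [hkz]; exact_mod_cast Nat.succ_pos _
    have h1 : |Pk| ≤ Tk := by
      rw [Int.abs_eq_natAbs, hTk]; exact_mod_cast hPk
    obtain ⟨hlo, hhi⟩ := abs_le.mp h1
    -- the cuts of depth k hold for Pk :: ps
    have hcutk : ∀ c ∈ CT.getD pre.length [], 0 ≤ c.2 + (List.zipWith (· * ·) c.1 (Pk :: ps)).sum := by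
      intro c hc
      have := hcut (pre.length + 1) (by omega) (by omega) c (by rwa [Nat.add_sub_cancel])
      rwa [hcons] at this
    have hb := cutBounds_spec (CT.getD pre.length []) ps (-Tk) Tk Pk hlo hhi hcutk
    refine ⟨ak, ?_, ?_⟩
    · rw [mem_icc]
      constructor
      · rw [neg_le, Int.le_ediv_iff_mul_le hkpos]
        have : Pk = -(kz * ak) - S := hhead
        nlinarith [hb.2]
      · rw [Int.le_ediv_iff_mul_le hkpos]
        have : Pk = -(kz * ak) - S := hhead
        nlinarith [hb.1]
    · have hnext : (-(kz * ak) + -S) :: ps = psumsRev (palC a) (pre ++ [ak]).length := by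
        rw [List.length_append, List.length_singleton, hcons, hhead, sub_eq_add_neg]
      rw [hnext]
      apply ih (pre ++ [ak]) (by simp; omega)
      rw [List.length_append, List.length_singleton, List.take_succ_eq_append_getElem (by omega), ← hpre, hak,
        List.getD_eq_getElem _ _ (by omega)]

/-! ## From polynomials to the search -/

/-- A `zipWith` sum against `psumsRev` is a sum over `P_1,…,P_k`. -/
theorem sum_zipWith_psumsRev (lams cs : List ℤ) (k : ℕ) :
    (List.zipWith (· * ·) lams (psumsRev cs k)).sum =
      ∑ j ∈ Finset.range k, lams.getD (k - 1 - j) 0 * (psumsRev cs (j + 1)).getD 0 0 := by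
  rw [sum_zipWith_mul_eq, length_psumsRev, ← Finset.sum_range_reflect]
  apply Finset.sum_congr rfl
  intro j hj
  rw [Finset.mem_range] at hj
  rw [getD_psumsRev cs k _ (by omega), show k - (k - 1 - j) = j + 1 by omega]

/-- **The cuts hold for small-measure palindromic polynomials.** For monic palindromic `p ∈ ℤ[X]` of degree `2d ≥ 2`
with `M(p) < B` and a valid cut `c` of depth `k`: `0 ≤ N + Σ_j λ_j P_j(p)`. -/
theorem cut_holds {p : ℤ[X]} {d : ℕ} (hmonic : p.Monic) (hdeg : p.natDegree = 2 * d)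
    (hpal : ∀ j ≤ 2 * d, p.coeff j = p.coeff (2 * d - j)) {B : ℝ} (hB : intMahlerMeasure p < B) {k : ℕ}
    {c : List ℤ × ℤ} (hc : CutValid d k B c) :
    0 ≤ c.2 + (List.zipWith (· * ·) c.1 (psumsRev (descCoeffList p) k)).sum := by
  obtain ⟨-, v, hv, hlam, hconst⟩ := hc
  -- half-root factorisation
  obtain ⟨s', hcard, hs0, hP⟩ := palindromic_halfRoots_factorisation (p.map (Int.castRingHom ℂ)) d
    (hmonic.map _) (by rw [natDegree_map_eq_of_injective (Int.castRingHom ℂ).injective_int, hdeg])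
    (fun j hj => by rw [coeff_map, coeff_map, hpal j hj])
  have hB' : (s'.map fun α => ((X - C α) * (X - C α⁻¹) : ℂ[X])).prod.mahlerMeasure ≤ B := by
    rw [← hP]; exact hB.le
  have hcut := trigCut_halfRoots s' hs0 (v.map (Int.cast : ℤ → ℝ)) hB'
  rw [hcard, List.length_map, hv, Finset.sum_range_succ, Finset.sum_range_succ, lamZero_map_cast] at hcut
  simp only [lamAt_map_cast] at hcut
  rw [lamAt_eq_zero_of_le v (by omega)] at hcut
  simp only [Int.cast_zero, zero_mul, add_zero, abs_zero] at hcut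
  -- identify the power sums
  have hre : ∀ j ∈ Finset.range k, (((s'.map fun α => α ^ (j + 1) + α⁻¹ ^ (j + 1)).sum).re / 2) =
      (((psumsRev (descCoeffList p) (j + 1)).getD 0 0 : ℤ) : ℝ) / 2 := by
    intro j _
    rw [← roots_powerSum_eq, ← hP, ← rootPowerSum_def, rootPowerSum_eq_head hmonic (by omega), Complex.intCast_re]
  rw [Finset.sum_congr rfl (fun j hj => by rw [hre j hj])] at hcut
  -- integrality
  rw [sum_zipWith_psumsRev c.1 _ k]
  have hsum : (((∑ j ∈ Finset.range k, c.1.getD (k - 1 - j) 0 * (psumsRev (descCoeffList p) (j + 1)).getD 0 0 : ℤ)) : ℝ)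
      = 2 * ∑ j ∈ Finset.range k, ((lamAt v (j + 1) : ℤ) : ℝ) *
          ((((psumsRev (descCoeffList p) (j + 1)).getD 0 0 : ℤ) : ℝ) / 2) := by
    push_cast
    rw [Finset.mul_sum]
    apply Finset.sum_congr rfl
    intro j hj
    rw [Finset.mem_range] at hj
    rw [hlam j hj]; ring
  have key : (-(c.2 + 1) : ℝ) <
      ((∑ j ∈ Finset.range k, c.1.getD (k - 1 - j) 0 * (psumsRev (descCoeffList p) (j + 1)).getD 0 0 : ℤ) : ℝ) := by
    rw [hsum]
    have hslack : ∑ j ∈ Finset.range k, |((lamAt v (j + 1) : ℤ) : ℝ)| * ((B ^ (j + 1) + (B ^ (j + 1))⁻¹) / 2 - 1) =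
        (∑ j ∈ Finset.range k, |((lamAt v (j + 1) : ℤ) : ℝ)| * (B ^ (j + 1) + (B ^ (j + 1))⁻¹ - 2)) / 2 := by
      rw [Finset.sum_div]
      apply Finset.sum_congr rfl
      intro j _; ring
    rw [hslack] at hcut
    linarith
  have key' : -(c.2 + 1) < ∑ j ∈ Finset.range k, c.1.getD (k - 1 - j) 0 * (psumsRev (descCoeffList p) (j + 1)).getD 0 0 := by
    exact_mod_cast key
  omega

/-- **Soundness of the search with cuts, for polynomials.** A monic palindromic `p ∈ ℤ[X]` of degree `2d ≥ 2` with
`M(p) < B` has its half coefficient vector in `censusSearchC T CT d [] []`, for valid thresholds (`|T| ≥ d`) and a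
valid cut table. -/
theorem take_descCoeffList_mem_censusSearchC {p : ℤ[X]} {d : ℕ} (hd : 1 ≤ d) (hmonic : p.Monic)
    (hdeg : p.natDegree = 2 * d) (hpal : ∀ j ≤ 2 * d, p.coeff j = p.coeff (2 * d - j)) {B : ℝ}
    (hB : intMahlerMeasure p < B) {T : List ℕ} (hdT : d ≤ T.length) (hT : ThresholdsValid d B T)
    {CT : List (List (List ℤ × ℤ))} (hCT : CutTableValid d B CT) :
    (descCoeffList p).take d ∈ censusSearchC T CT d [] [] := by
  apply mem_censusSearchC hdT _ (by rw [List.length_take, length_descCoeffList, hdeg]; omega)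
  · intro k hk1 hk2
    rw [palC_take_descCoeffList hd hmonic hdeg hpal]
    have hP := rec_even_powerSum_test p d hd hmonic hdeg hpal hB (k := k) (by omega)
    rw [← rootPowerSum_def, rootPowerSum_eq_head hmonic hk1, Complex.norm_intCast] at hP
    have hTk := hT k hk1 hk2
    set N := (psumsRev (descCoeffList p) k).getD 0 0
    have h1 : (|N| : ℝ) < (T.getD (k - 1) 0 : ℝ) + 1 := lt_of_lt_of_le hP hTk
    have h2 : |N| < (T.getD (k - 1) 0 : ℤ) + 1 := by exact_mod_cast h1
    have h3 : (N.natAbs : ℤ) ≤ (T.getD (k - 1) 0 : ℤ) := by rw [Int.natCast_natAbs]; omega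
    exact_mod_cast h3
  · intro k hk1 hk2 c hc
    rw [palC_take_descCoeffList hd hmonic hdeg hpal]
    exact cut_holds hmonic hdeg hpal hB (hCT k hk1 hk2 c hc)

end Summit.Ventures.DiscreteObjects.Mahler
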